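/-
Copyright (c) 2026 the pub-hodgecm-mathlib formalisation cell (harness21).  Prover seat hodgecm-mathlib-K2Liu-p09 (g4): Track B «K2-LIT», #184♮ = hLiu418,
Road I organ (A-int)-fin, generic brick for D-A′ (the Kudla–Rallis mixed-model map `r_w`): FIBRE INTEGRALS OF SCHWARTZ–BRUHAT FUNCTIONS
(LEAD F0P6-plan (g12) M-156g; dealer K2E5-plan (g5) SIGS-RoadI-v3 v3.7 §A-int (b)).
-/
import Literature.NumberTheory.Automorphic.TateLocalFactors      -- ★ `SchwartzBruhat X` (locally constant, compactly supported)
import Mathlib.MeasureTheory.Integral.Bochner.Basic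
import HarnessLib

/-!
# Fibre integrals of Schwartz–Bruhat functions are Schwartz–Bruhat

Cell `hodgecm-mathlib`, crux item hLiu418 = `stmt-HodgeConjecture-24832`; squad K2 ∕ K2Liu, prover K2Liu-p09 (g4).  THEOREMS ONLY (no `def`, no instance,
no notation, no named fact, no `sorry`); lane `--supports stmt-HodgeConjecture-24832 --as helper`.  GENERIC topology (any spaces `X`, `Y`, any measure on `Y`):

* `exists_mem_nhds_forall_apply_eq` — a locally constant compactly supported `f : X × Y → E` is, near every `x₀`, CONSTANT IN `x` UNIFORMLY IN `y`:
  `∃ U ∈ 𝓝 x₀, ∀ x ∈ U, ∀ y, f (x, y) = f (x₀, y)` (rectangles around the compact `y`-shadow of the support; zero outside it).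
* `isLocallyConstant_integral_prod_right` — hence `x ↦ ∫ f (x, y) dμ(y)` is locally constant (NO measurability needed);
  `hasCompactSupport_integral_prod_right` — and compactly supported (inside the `x`-shadow of `tsupport f`; `X` Hausdorff);
  `integral_prod_right_mem_schwartzBruhat` — so it is Schwartz–Bruhat; `comp_homeomorph_mem_schwartzBruhat` — transport along homeomorphisms;
  `integral_sum_elim_mem_schwartzBruhat` — the COORDINATE form on `ι ⊕ κ → F`: `a ↦ ∫ f (Sum.elim a b) dμ(b)` is Schwartz–Bruhat on `ι → F`.
This is the analytic half of the mixed-model ∕ Kudla–Rallis map `r_w` («integrate the `X^{⊕n}`-coordinate») of the Road I sheet; the other half (restriction to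
`Y = 0`) is `comp_continuous`.

HONEST LABEL: HC_CM is proved only modulo the printed citations (2 remaining named inputs: hLiu418 = stmt-HodgeConjecture-24832, h413 = stmt-HodgeConjecture-24833)
until rung 0 closes; generic bookkeeping, closes no item.
References: [Weil1964] n° 11 (Schwartz–Bruhat functions on products, partial integration); [KudlaRallis1994] §1; [MoeglinVignerasWaldspurger1987] Chap. 2 I.4.
-/

set_option autoImplicit false
set_option linter.dupNamespace false

noncomputable section

open MeasureTheory Filter Topology
open Literature.NumberTheory.Automorphic

namespace Summit.HodgeConjecture.HodgeConjecture.Cruxes.HLiu418.K2LiuSchwartzBruhatFiberIntegral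

section Generic

variable {X Y : Type*} [TopologicalSpace X] [TopologicalSpace Y] {E : Type*}

/-- **uniform local constancy in the first variable**: for `f : X × Y → E` locally constant with compact support (`Zero E`) and `x₀ : X`, there is a
neighbourhood `U` of `x₀` with `f (x, y) = f (x₀, y)` for all `x ∈ U` and ALL `y`. [cite: Weil1964, n° 11] -/
theorem exists_mem_nhds_forall_apply_eq [Zero E] {f : X × Y → E} (hf : IsLocallyConstant f) (hs : HasCompactSupport f) (x₀ : X) :
    ∃ U ∈ 𝓝 x₀, ∀ x ∈ U, ∀ y, f (x, y) = f (x₀, y) := by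
  -- a rectangle around each `(x₀, y)` on which `f` is constant
  have hrect : ∀ y : Y, ∃ U ∈ 𝓝 x₀, ∃ V ∈ 𝓝 y, ∀ x ∈ U, ∀ y' ∈ V, f (x, y') = f (x₀, y') := by
    intro y
    have hopen : IsOpen (f ⁻¹' {f (x₀, y)}) := hf.isOpen_fiber _
    obtain ⟨u, v, hu, hxu, hv, hyv, huv⟩ := mem_nhds_prod_iff'.1 (hopen.mem_nhds (by exact rfl))
    refine ⟨u, hu.mem_nhds hxu, v, hv.mem_nhds hyv, fun x hx y' hy' => ?_⟩
    have h1 : f (x, y') = f (x₀, y) := huv (Set.mk_mem_prod hx hy')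
    have h2 : f (x₀, y') = f (x₀, y) := huv (Set.mk_mem_prod hxu hy')
    rw [h1, h2]
  choose U hU V hV hUV using hrect
  -- the compact `y`-shadow of the support is covered by finitely many `V y`
  have hK : IsCompact (Prod.snd '' tsupport f) := hs.image continuous_snd
  obtain ⟨t, -, htK⟩ := hK.elim_nhds_subcover V (fun y _ => hV y)
  refine ⟨⋂ y ∈ t, U y, (Filter.biInter_finset_mem t).2 fun y _ => hU y, fun x hx y => ?_⟩
  by_cases hy : y ∈ Prod.snd '' tsupport f
  · obtain ⟨y₀, hy₀t, hyV⟩ : ∃ y₀ ∈ t, y ∈ V y₀ := by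
      have := htK hy
      simp only [Set.mem_iUnion, exists_prop] at this
      exact this
    exact hUV y₀ x ((Set.mem_iInter₂.1 hx) y₀ hy₀t) y hyV
  · -- outside the shadow both values vanish
    have h0 : ∀ x' : X, f (x', y) = 0 := fun x' => by
      refine image_eq_zero_of_notMem_tsupport fun hmem => hy ⟨(x', y), hmem, rfl⟩
    rw [h0 x, h0 x₀]

variable [NormedAddCommGroup E] [NormedSpace ℝ E] [MeasurableSpace Y] (μ : Measure Y)

/-- **the fibre integral of a locally constant compactly supported function is locally constant** (no measurability hypothesis: near `x₀` the integrands
`f (x, ·)` and `f (x₀, ·)` coincide as functions). [cite: Weil1964, n° 11] -/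
theorem isLocallyConstant_integral_prod_right {f : X × Y → E} (hf : IsLocallyConstant f) (hs : HasCompactSupport f) :
    IsLocallyConstant fun x => ∫ y, f (x, y) ∂μ := by
  refine (IsLocallyConstant.iff_eventually_eq _).2 fun x₀ => ?_
  obtain ⟨U, hU, h⟩ := exists_mem_nhds_forall_apply_eq hf hs x₀
  filter_upwards [hU] with x hx
  exact integral_congr_ae (Eventually.of_forall fun y => h x hx y)

/-- **the fibre integral has compact support** (inside the `x`-shadow of `tsupport f`; `X` Hausdorff). [cite: Weil1964, n° 11] -/
theorem hasCompactSupport_integral_prod_right [T2Space X] {f : X × Y → E} (hs : HasCompactSupport f) :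
    HasCompactSupport fun x => ∫ y, f (x, y) ∂μ := by
  refine HasCompactSupport.intro (hs.image continuous_fst) fun x hx => ?_
  have h0 : ∀ y, f (x, y) = 0 := fun y =>
    image_eq_zero_of_notMem_tsupport fun hmem => hx ⟨(x, y), hmem, rfl⟩
  simp only [h0, integral_zero]

end Generic

section Complex

variable {X Y : Type*} [TopologicalSpace X] [TopologicalSpace Y] [MeasurableSpace Y] (μ : Measure Y)

/-- **fibre integrals of Schwartz–Bruhat functions are Schwartz–Bruhat**: `f ∈ 𝒮(X × Y) ⟹ (x ↦ ∫ f (x, y) dμ(y)) ∈ 𝒮(X)` (`X` Hausdorff).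
[cite: Weil1964, n° 11] [cite: KudlaRallis1994, §1] -/
theorem integral_prod_right_mem_schwartzBruhat [T2Space X] {f : X × Y → ℂ} (hf : f ∈ SchwartzBruhat (X × Y)) :
    (fun x => ∫ y, f (x, y) ∂μ) ∈ SchwartzBruhat X :=
  ⟨isLocallyConstant_integral_prod_right μ hf.1 hf.2, hasCompactSupport_integral_prod_right μ hf.2⟩

omit [MeasurableSpace Y] in
/-- transport of Schwartz–Bruhat functions along a homeomorphism. [cite: Weil1964, n° 11] -/
theorem comp_homeomorph_mem_schwartzBruhat (e : Y ≃ₜ X) {f : X → ℂ} (hf : f ∈ SchwartzBruhat X) : (f ∘ e) ∈ SchwartzBruhat Y :=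
  ⟨hf.1.comp_continuous e.continuous, hf.2.comp_homeomorph e⟩

omit [MeasurableSpace Y] in
/-- restriction to a closed embedded slice `y ↦ f (i y)` along a continuous CLOSED EMBEDDING keeps Schwartz–Bruhat (e.g. `Y = 0` in the mixed model).
[cite: Weil1964, n° 11] -/
theorem comp_isClosedEmbedding_mem_schwartzBruhat {i : Y → X} (hi : Topology.IsClosedEmbedding i) {f : X → ℂ} (hf : f ∈ SchwartzBruhat X) :
    (f ∘ i) ∈ SchwartzBruhat Y :=
  ⟨hf.1.comp_continuous hi.continuous, hf.2.comp_isClosedEmbedding hi⟩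

end Complex

section Coordinates

variable {F : Type*} [TopologicalSpace F] [T2Space F] {ι κ : Type*} [MeasurableSpace (κ → F)] (μ : Measure (κ → F))

/-- **coordinate form**: for `f ∈ 𝒮(ι ⊕ κ → F)`, integrating out the `κ`-block gives a Schwartz–Bruhat function of the `ι`-block:
`(a ↦ ∫ f (Sum.elim a b) dμ(b)) ∈ 𝒮(ι → F)` (Mathlib `Homeomorph.sumArrowHomeomorphProdArrow`). [cite: Weil1964, n° 11] [cite: KudlaRallis1994, §1] -/
theorem integral_sum_elim_mem_schwartzBruhat {f : (ι ⊕ κ → F) → ℂ} (hf : f ∈ SchwartzBruhat (ι ⊕ κ → F)) :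
    (fun a : ι → F => ∫ b : κ → F, f (Sum.elim a b) ∂μ) ∈ SchwartzBruhat (ι → F) := by
  have h := integral_prod_right_mem_schwartzBruhat μ
    (comp_homeomorph_mem_schwartzBruhat (Homeomorph.sumArrowHomeomorphProdArrow).symm hf)
  refine (congrArg (· ∈ SchwartzBruhat (ι → F)) ?_).mp h
  funext a
  refine integral_congr_ae (Eventually.of_forall fun b => ?_)
  show f ((Homeomorph.sumArrowHomeomorphProdArrow).symm (a, b)) = f (Sum.elim a b)
  congr 1

end Coordinates

end Summit.HodgeConjecture.HodgeConjecture.Cruxes.HLiu418.K2LiuSchwartzBruhatFiberIntegral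

end
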